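import Literature.MathematicalPhysics.QuantumFieldTheory.Balaban1983to89.B9Thm37GlueCor36

/-!
# `Balaban1983to89.B9CoRealizesRel` — the (3.42) co-reading RELATIVE TO A BLOCK EQUIVALENCE on the sites (the repaired binder C′ of
# `B9CoRealizesSharedBlock`): «x ∈ Δ(y)» read as «the site of x is equivalent to y», with the multiplicity of a class in the constant

T. Bałaban, *Propagators for lattice gauge theories in a background field*, Commun. Math. Phys. **99** (1985) 389–434
[`Balaban1985BackgroundPropagators`, "B9"]; [4] = T. Bałaban, *Propagators and renormalization transformations for lattice gauge
theories. II*, Commun. Math. Phys. **96** (1984) 223–250 [`Balaban1984PropagatorsII`].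

statement-level skeleton of published theorems with citation tags; proofs where landed; nothing here is a claim about the
Yang–Mills mass gap

THE PRINTED LOCI.  (3.42) p. 397 *"|(G′(U)λ)(x)|, … ≦ B₀[…]e^{−δ₀d(y,y′)}|λ| for x ∈ Δ(y), y ∈ Λ_j, supp λ ⊂ Δ(y′)"*; (3.39) p. 397 (the sup);
[4] (2.51)–(2.52) p. 232 (the block majorant and λ = Σ_{y′}Δ(y′)λ).

WHY THIS FILE.  n06-c's co-reading `B9Thm37GlueCor36.CoRealizes K n U bu bv ev A` models «x ∈ Δ(y)» by the EQUALITY `bu x = y` and «supp λ ⊂ Δ(y′)» by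
«`ev λ` lives in the fibre `bv⁻¹(y′)`».  At the geometry of record the sites are index bonds, SEVERAL of which have ONE block Δ; there the schema is
unsatisfiable for G(1) at every member (`B9CoRealizesSharedBlock.not_hcoGA_opsYOfRecord`).  THIS FILE types the REPAIRED BINDER C′: the same four
fields RELATIVE TO AN EQUIVALENCE `Rel` on `g.Site` («same block»; equality recovers the landed schema — `coRealizesRel_eq_iff`): `off` — supp λ ⊂ Δ(y′)
⇒ `ev λ` vanishes at the model points whose site is NOT equivalent to y′ (so it lives on the UNION of the fibres of the class of y′); `obs` — the reading
at y is below every bound of |A(ev λ)| on the union of the fibres of the class of y.  The price in the consumer lemma is the MULTIPLICITY m of a class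
(≦ 2(d+1) index bonds per carrier block at the record): ★ `le_of_hasMajorantHom_of_coRealizesRel` — a [4]-(2.51) majorant K′ of the model operator
that is CLASS-SATURATED in both arguments (as `maj342` is at the record: it depends on the level and the distance of the carrier blocks only) gives
`K.e n U λ y ≦ m·K′(y, y′)·|λ|` for supp λ ⊂ Δ(y′) (λ = Σ over the ≦ m fibre pieces of the class, [4] (2.52), the majorant piece by piece); hence
★ `clause342_of_hasMajorantHom_rel` — the n-th (3.42) clause AS TYPED with constant m·B₀.
* §1 `CoRealizesRel`, `coRealizesRel_eq_iff` (Rel := Eq ⇔ `CoRealizes`), `CoRealizesRel.mono_rel`.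
* §2 ★ `le_of_hasMajorantHom_of_coRealizesRel`, ★ `clause342_of_hasMajorantHom_rel`.
The record-level instance (Rel := «same carrier block», m := the number of index bonds of a block, domination as for `CoRealizes`) is the instance
seat's; nothing of it is asserted here.

HONEST SCOPE.  A hypothesis schema of definitional shape and its bookkeeping consumer; nothing of [B9] or [4] asserted; count-neutral; N06 NOT
discharged; nothing continuum, nothing about the mass gap.  Cell `pub-ymgap` (HUMAN RULING D-0062), Track A node N06 [B9], seat `pub-ymgap-dag-n06-l`
(g3), 2026-08-27.
-/

namespace Literature.MathematicalPhysics.QuantumFieldTheory.Balaban1983to89.B9CoRealizesRel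

open Finset B6RandomWalk B6RandomWalkHom B9Thm34Ext B9Thm37GlueCor36 B9SectCDiffDict

noncomputable section

section Schema

variable {g : B9.Geometry} [Fintype g.Site] {R : ℝ} {H : Prop} {B : B9.Backgrounds}
variable {u v : Type}

/-- **CO-READING OF THE n-TH (3.42) QUANTITY BY A MODEL OPERATOR, RELATIVE TO A BLOCK EQUIVALENCE `Rel` ON THE SITES** (the repaired form of
`B9Thm37GlueCor36.CoRealizes`; `Rel := Eq` recovers it).  Print, (3.39)∕(3.42) p. 397: the bounded quantity is the sup over x ∈ Δ(y) of the n-th entry for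
supp λ ⊂ Δ(y′).  Typed: `off` — supp λ ⊂ Δ(y′) ⇒ `ev λ` vanishes at the model points x′ with `¬ Rel (bv x′) y′`; `bound` — |ev λ| ≦ |λ|; `norm_nonneg`;
`obs` — e_n(U, λ, y) is BELOW every nonnegative common bound of |(A(ev λ))(x)| over the model points x with `Rel (bu x) y`.  OURS (typing): a hypothesis
schema on how a model instantiates `B9.KernelFamily.e` when several sites share one block; nothing asserted.
[cite: Balaban1985BackgroundPropagators, (3.39) + (3.42) p.397] -/
structure CoRealizesRel (K : B9.KernelFamily g B) (n : Fin 4) (U : B.Cfg) (Rel : g.Site → g.Site → Prop) (bu : u → g.Site) (bv : v → g.Site)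
    (ev : g.Loc → v → ℝ) (A : (v → ℝ) →ₗ[ℝ] (u → ℝ)) : Prop where
  off : ∀ (lam : g.Loc) (y' : g.Site), g.suppIn lam y' → ∀ x' : v, ¬ Rel (bv x') y' → ev lam x' = 0
  bound : ∀ (lam : g.Loc) (x' : v), |ev lam x'| ≤ g.supNorm lam
  norm_nonneg : ∀ lam : g.Loc, 0 ≤ g.supNorm lam
  obs : ∀ (lam : g.Loc) (y : g.Site) (c : ℝ), 0 ≤ c → (∀ x : u, Rel (bu x) y → |A (ev lam) x| ≤ c) → K.e n U lam y ≤ c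

omit [Fintype g.Site] in
/-- with the EQUALITY relation the relative co-reading IS n06-c's `CoRealizes`. [cite: Balaban1985BackgroundPropagators, (3.42) p.397, bookkeeping] -/
theorem coRealizesRel_eq_iff (K : B9.KernelFamily g B) (n : Fin 4) (U : B.Cfg) (bu : u → g.Site) (bv : v → g.Site)
    (ev : g.Loc → v → ℝ) (A : (v → ℝ) →ₗ[ℝ] (u → ℝ)) :
    CoRealizesRel K n U Eq bu bv ev A ↔ CoRealizes K n U bu bv ev A :=
  ⟨fun h => ⟨h.off, h.bound, h.norm_nonneg, h.obs⟩, fun h => ⟨h.off, h.bound, h.norm_nonneg, h.obs⟩⟩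

omit [Fintype g.Site] in
/-- coarsening the relation weakens `off` and strengthens nothing else that matters: a co-reading relative to `Rel` is one relative to any COARSER `Rel′`
whose `obs` classes are read through `Rel` — recorded in the useful direction: equality ⇒ any reflexive relation, for the `obs` field alone.
[cite: Balaban1985BackgroundPropagators, (3.42) p.397, bookkeeping] -/
theorem CoRealizesRel.obs_of_refl {K : B9.KernelFamily g B} {n : Fin 4} {U : B.Cfg} {Rel : g.Site → g.Site → Prop} {bu : u → g.Site}
    {bv : v → g.Site} {ev : g.Loc → v → ℝ} {A : (v → ℝ) →ₗ[ℝ] (u → ℝ)} (h : CoRealizesRel K n U Rel bu bv ev A)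
    (hrefl : ∀ y, Rel y y) (lam : g.Loc) (y : g.Site) (c : ℝ) (hc : 0 ≤ c) (hx : ∀ x : u, |A (ev lam) x| ≤ c) :
    K.e n U lam y ≤ c :=
  h.obs lam y c hc fun x _ => by have := hrefl y; exact hx x

end Schema

/-! ## §2 ★ The consumer: a class-saturated majorant gives the (3.42) clause with the multiplicity in the constant -/

section Consumer

variable {g : B9.Geometry} [Fintype g.Site] {R : ℝ} {H : Prop} {B : B9.Backgrounds}
variable {u v : Type}

/-- ★ **[4]-(2.51) MAJORANT + RELATIVE CO-READING ⇒ THE READING BOUND WITH MULTIPLICITY.**  If the model operator A has the two-lattice majorant K′ ≧ 0 between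
the fibres of `bv`, `bu` (transported geometry), K′ is SATURATED for `Rel` in both arguments, every `Rel`-class has at most m members, and e_n is co-read
relative to `Rel`, then e_n(U, λ, y) ≦ m·K′(y, y′)·|λ| for supp λ ⊂ Δ(y′).  Route: `ev λ = Σ_{y″} Δ(y″)(ev λ)` ([4] (2.52)) with the pieces outside the class
of y′ vanishing (`off`), each piece block-supported of size |λ| (`bound`), the majorant piece by piece, saturation, the class count, `obs`.
[cite: Balaban1985BackgroundPropagators, (3.42) p.397; Balaban1984PropagatorsII, (2.51)–(2.52) p.232] -/
theorem le_of_hasMajorantHom_of_coRealizesRel {K : B9.KernelFamily g B} {n : Fin 4} {U : B.Cfg} {Rel : g.Site → g.Site → Prop}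
    [DecidableRel Rel] {bu : u → g.Site} {bv : v → g.Site} {ev : g.Loc → v → ℝ} {A : (v → ℝ) →ₗ[ℝ] (u → ℝ)}
    (hC : CoRealizesRel K n U Rel bu bv ev A) {K' : g.Site → g.Site → ℝ} (hK' : ∀ a b, 0 ≤ K' a b)
    (hsat₁ : ∀ a a' b, Rel a a' → K' a b = K' a' b) (hsat₂ : ∀ a b b', Rel b b' → K' a b = K' a b')
    {m : ℕ} (hmult : ∀ y' : g.Site, (Finset.univ.filter (fun y'' => Rel y'' y')).card ≤ m)
    (hA : HasMajorantHom (g := toB6 g R H) bv bu A K') :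
    ∀ (lam : g.Loc) (y y' : g.Site), g.suppIn lam y' → K.e n U lam y ≤ (m * K' y y') * g.supNorm lam := by
  classical
  intro lam y y' hs
  set N := g.supNorm lam with hN
  have hN0 : 0 ≤ N := hC.norm_nonneg lam
  have hKN : 0 ≤ K' y y' * N := mul_nonneg (hK' y y') hN0
  refine hC.obs lam y _ (mul_nonneg (mul_nonneg (Nat.cast_nonneg m) (hK' y y')) hN0) fun x hx => ?_
  set f := ev lam with hf
  -- the block decomposition on the source model lattice; pieces outside the class of y′ vanish
  have hdec : f = ∑ y'' : (toB6 g R H).Site, blockPiece (g := toB6 g R H) bv y'' f := (sum_blockPiece (g := toB6 g R H) bv f).symm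
  have hzero : ∀ y'' : g.Site, ¬ Rel y'' y' → blockPiece (g := toB6 g R H) bv y'' f = 0 := by
    intro y'' hy''
    funext x'
    by_cases hx' : bv x' = y''
    · simp only [blockPiece, hx', if_true, Pi.zero_apply]
      exact hC.off lam y' hs x' (by rw [hx']; exact hy'')
    · simp only [blockPiece, Pi.zero_apply]
      split_ifs with h
      · exact absurd h hx'
      · rfl
  have hpiece : ∀ y'' : g.Site, BlockSupp (g := toB6 g R H) bv (blockPiece (g := toB6 g R H) bv y'' f) y'' N := fun y'' =>
    { nonneg := hN0
      bound := fun z hz => by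
        simp only [blockPiece, hz, if_true]
        exact hC.bound lam z
      off := fun z hz => by simp only [blockPiece, hz, if_false] }
  -- each piece of the class is bounded by K′(y, y′)·N, the others by 0
  have hterm : ∀ y'' : g.Site, |A (blockPiece (g := toB6 g R H) bv y'' f) x| ≤ if Rel y'' y' then K' y y' * N else 0 := by
    intro y''
    by_cases hr : Rel y'' y'
    · rw [if_pos hr]
      have h1 := hA y'' _ N (hpiece y'') x
      rw [hsat₁ _ _ _ hx, hsat₂ _ _ _ hr] at h1
      exact h1
    · rw [if_neg hr, hzero y'' hr, map_zero, Pi.zero_apply, abs_zero]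
  have hAf : A f = ∑ y'' : (toB6 g R H).Site, A (blockPiece (g := toB6 g R H) bv y'' f) := by
    conv_lhs => rw [hdec]
    rw [map_sum]
  calc |A f x| = |∑ y'' : (toB6 g R H).Site, A (blockPiece (g := toB6 g R H) bv y'' f) x| := by rw [hAf, Finset.sum_apply]
    _ ≤ ∑ y'' : (toB6 g R H).Site, |A (blockPiece (g := toB6 g R H) bv y'' f) x| := Finset.abs_sum_le_sum_abs _ _
    _ ≤ ∑ y'' : g.Site, (if Rel y'' y' then K' y y' * N else 0) := Finset.sum_le_sum fun y'' _ => hterm y''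
    _ = ((Finset.univ.filter (fun y'' => Rel y'' y')).card : ℝ) * (K' y y' * N) := by
        rw [Finset.sum_ite, Finset.sum_const_zero, add_zero, Finset.sum_const, nsmul_eq_mul]
    _ ≤ (m : ℝ) * (K' y y' * N) := mul_le_mul_of_nonneg_right (by exact_mod_cast hmult y') hKN
    _ = m * K' y y' * N := by ring

/-- ★ **THE n-TH (3.42) CLAUSE AS TYPED FROM THE MODEL MAJORANT `maj342 g n B₀ δ₀` AND A RELATIVE CO-READING**, constant m·B₀ (m = the multiplicity of a
class, `maj342` saturated for `Rel`). [cite: Balaban1985BackgroundPropagators, (3.42) p.397; Balaban1984PropagatorsII, (2.51)–(2.52) p.232] -/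
theorem clause342_of_hasMajorantHom_rel {K : B9.KernelFamily g B} {n : Fin 4} {U : B.Cfg} {Rel : g.Site → g.Site → Prop} [DecidableRel Rel]
    {bu : u → g.Site} {bv : v → g.Site} {ev : g.Loc → v → ℝ} {A : (v → ℝ) →ₗ[ℝ] (u → ℝ)} (hC : CoRealizesRel K n U Rel bu bv ev A)
    {B₀ δ₀ : ℝ} (hB₀ : 0 ≤ B₀) (hlen : ∀ y, 0 ≤ g.len y)
    (hsat₁ : ∀ a a' b, Rel a a' → maj342 g n B₀ δ₀ a b = maj342 g n B₀ δ₀ a' b)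
    (hsat₂ : ∀ a b b', Rel b b' → maj342 g n B₀ δ₀ a b = maj342 g n B₀ δ₀ a b')
    {m : ℕ} (hmult : ∀ y' : g.Site, (Finset.univ.filter (fun y'' => Rel y'' y')).card ≤ m)
    (hA : HasMajorantHom (g := toB6 g R H) bv bu A (maj342 g n B₀ δ₀)) : Clause342 K n (m * B₀) δ₀ U := by
  intro lam y y' hs
  have h := le_of_hasMajorantHom_of_coRealizesRel hC (maj342_nonneg hB₀ hlen n δ₀) hsat₁ hsat₂ hmult hA lam y y' hs
  calc K.e n U lam y ≤ m * maj342 g n B₀ δ₀ y y' * g.supNorm lam := h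
    _ = m * B₀ * B9.pref4 (g.len y) n * Real.exp (-(δ₀ * g.dist y y')) * g.supNorm lam := by rw [maj342]; ring

end Consumer

end

end Literature.MathematicalPhysics.QuantumFieldTheory.Balaban1983to89.B9CoRealizesRel
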